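import Summits.CriticalPhenomena.PercolationContinuityZ3.Theorems.PercNearOneGluingNoHeavyQuantRootReductionGapCert
import Summits.CriticalPhenomena.PercolationContinuityZ3.Theorems.PercNearOneGluingNoHeavyQuantDIBStar
import Summits.CriticalPhenomena.PercolationContinuityZ3.Theorems.PercNearOneGluingNoHeavyQuantIndepBlobGapCompanion
import Summits.CriticalPhenomena.PercolationContinuityZ3.Theorems.PercNearOneGluingNoHeavyQuantIndepBlobGapPairs
import HarnessLib

/-!
# QUANT lane R8, FAR on general trees — certificate rules γ⁗ for the root reduction: a TERM is certified in CLOSED FORM by one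
# heavy COMPANION of its light cloud (`IndepBlob.tail_ge_of_companion_cloud` / `…_oneLight`, lead g16), or by a MATCHING of the
# lights to heavy companions (`IndepBlob.tail_ge_of_matched_companions`), with the sure shift

builds on p205010 (kernel theorem, internal audit signed; external expert review pending)

Support file (`--supports stmt-CriticalPhenomena-4575`), QUANT lane typer seat prim-quant-stmt (gen 18), rung R8 of
`run/shared/lean/prim/quant/LADDER.md`.  Second half of the gen-16 lead's ask (`prim-quant-lead-g16/LEAD-NOTES-G16.md` N30 (7)(a):
"… and the closed-form `tail_ge_of_companion_cloud`"); the first half (γ‴, the finite GAP check) is `…QuantRootReductionGapCert`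
(same seat, p254731).  Theorems only (local notation copied verbatim from `…QuantRootReduction`), no sorries, standard axioms.

SETTING.  A TERM of the root decomposition (`…QuantRootReduction`, typer g17) is `TERM[s, a, g, j] = P(s + Σ_{k open} a k ≥ j+1)`:
independent blobs `(a k, g k)` and a sure shift `s`, i.e. the blob system at layer `j − s`.  THE COMPANION CERTIFICATE (lead g16,
`…QuantIndepBlobGapCompanion`, N30 (4)): floor `1/2 ≤ x ≤ 1`; a CLOUD `L` of blobs with arbitrary gates (the term's light blobs), ONE
heavy COMPANION `k₀ ∉ L`, every other blob heavy; shortfall `e₀ = 2j' + 1 − A'' − a k₀` at layer `j'` (`A''` = total size of the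
others); if `a k₀ ≥ e₀` and for `y + w = e₀ + 1` (`y, w ≥ 1`): `x(1 − g k₀)·P(N_L ≤ y − 1) ≤ (1 − x)·g k₀·P(N_L ≥ w)`, then
`x ≤ P(N ≥ j'+1)` — no credit hypothesis; for ONE light blob `(b, γ)` with `b ≥ e₀` the cloud condition is
`odds(g k₀)·odds(γ) ≥ odds(x)`.  In the lead's exact corner samples (2–4 lights) the companion-cloud certificate covers 91.3 %, with
p1 g11's graded merge 97.0 %, the general gap check (γ‴) the rest.

* `Quant.RootDec.term_ge_of_companionCloud` — γ⁗: the companion-cloud certificate for `TERM[s, a, g, j]` (layer `j − s`; the size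
  and level bookkeeping carries `+ 2s`); void (β) when `s ≥ j + 1`.
* `Quant.RootDec.term_ge_of_companionOneLight` — γ⁗₁: one light blob `ℓ`, one companion `k₀`, all others heavy,
  `2(j − s) + 1 ≤ A'' + 2a k₀`, `2(j − s) + 1 ≤ A'' + a k₀ + a ℓ`, `x(1 − g k₀)(1 − g ℓ) ≤ (1 − x) g k₀ g ℓ` ⟹ `x ≤ TERM`.
* `Quant.RootDec.term_ge_of_matchedCompanions` — THE MATCHING ROW as a term rule (lead g16 N31, `IndepBlob.tail_ge_of_matched_companions`,
  `…QuantIndepBlobGapPairs`): every blob of a finset `L` matched injectively to its own heavy companion outside `L` of at least its size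
  with `odds(g (c ℓ))·odds(g ℓ) ≥ odds(x)`, every blob outside `L` heavy, `2j + 1 ≤ Σ a + 2s`, `1/2 ≤ x < 1` ⟹ `x ≤ TERM` (credit-free).
All three plug into R1 (`rtail_ge_of_terms`) exactly like β/α/γ‴ in `rtail_ge_of_gapCerts` (index type `κ : Type`, the sure shift by
`RootDec.term_shift` of `…QuantDIBStar`).  (The gen-16 lead wrote the same three wrappers as `T/…QuantRootDecGapCert` at 08:04Z; that file re-declares `RootDec.term_ge_of_gapCert`, in the tree since p254731,
so this file is the landing of record for the wrappers — lane INBOX 08:20Z.)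

[this work]; gap calculus and companion certificate: QUANT lane lead g16 (this lane); the gluing rows served
[cite: KozmaNitzan2024, Conjecture 3 (p. 15)]; product weights [cite: Grimmett1999, §1.3 p. 10].
-/

namespace Summit.CriticalPhenomena.PercolationContinuityZ3.Theorems

namespace Quant

namespace RootDec

open Finset

variable {κ : Type} [Fintype κ] [DecidableEq κ]

/-- product-Bernoulli weight of the set `W` of open blobs (as in `…QuantRootReduction`) -/
local notation3 "wt[" g ", " W "]" => ∏ k, (if k ∈ (W : Finset κ) then (g : κ → ℝ) k else 1 - (g : κ → ℝ) k)

/-- the TERM tail `P(s + Σ_{k open} a k ≥ j+1)` (as in `…QuantRootReduction`) -/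
local notation3 "TERM[" s ", " a ", " g ", " j "]" =>
  ∑ W : Finset κ, wt[g, W] * (if (j : ℕ) + 1 ≤ (s : ℕ) + ∑ k ∈ W, (a : κ → ℕ) k then (1 : ℝ) else 0)

/-- the restricted tail `P(N_S ≥ t)` of the blobs of `S` alone (the shape used by `…QuantIndepBlobGapCalculus`) -/
local notation3 "TLS[" g ", " a ", " S ", " t "]" =>
  ∑ u ∈ (S : Finset κ).powerset, (∏ i ∈ (S : Finset κ), (if i ∈ u then (g : κ → ℝ) i else 1 - (g : κ → ℝ) i)) *
    (if (t : ℕ) ≤ ∑ i ∈ u, (a : κ → ℕ) i then (1 : ℝ) else 0)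

/-- **γ⁗ — THE COMPANION-CLOUD CERTIFICATE FOR A TERM.**  Gates in `[0,1]`, floor `1/2 ≤ x ≤ 1`, a cloud `L` (any gates), a
heavy companion `k₀ ∉ L` (`x ≤ g k₀`), all other blobs heavy; with `A'' = Σ_{k ∉ insert k₀ L} a k`: `2j + 1 ≤ A'' + 2a k₀ + 2s`, and
for all `y, w ≥ 1` with `y + w + A'' + a k₀ + 2s = 2j + 2`:
`x(1 − g k₀)·(1 − P(N_L ≥ y)) ≤ (1 − x)·g k₀·P(N_L ≥ w)`.  Then `x ≤ TERM[s, a, g, j]`.  (Sure shift, then the lead's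
`IndepBlob.tail_ge_of_companion_cloud` at layer `j − s`.) [this work] -/
theorem term_ge_of_companionCloud (s : ℕ) (a : κ → ℕ) (g : κ → ℝ) (j : ℕ) (x : ℝ) (hx : 1 / 2 ≤ x) (hx1 : x ≤ 1)
    (hg : ∀ k, 0 ≤ g k ∧ g k ≤ 1) (L : Finset κ) (k₀ : κ) (hk₀ : k₀ ∉ L) (hk₀x : x ≤ g k₀)
    (hheavy : ∀ k, k ∉ insert k₀ L → x ≤ g k)
    (hbig : 2 * j + 1 ≤ (∑ k ∈ (insert k₀ L)ᶜ, a k) + 2 * a k₀ + 2 * s)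
    (hcloud : ∀ y w : ℕ, 1 ≤ y → 1 ≤ w → y + w + (∑ k ∈ (insert k₀ L)ᶜ, a k) + a k₀ + 2 * s = 2 * j + 2 →
      x * (1 - g k₀) * (1 - TLS[g, a, L, y]) ≤ (1 - x) * g k₀ * TLS[g, a, L, w]) :
    x ≤ TERM[s, a, g, j] := by
  by_cases hsj : j + 1 ≤ s
  · rw [term_eq_one_of_sure s a g j hsj]; exact hx1
  have hs : s ≤ j := by omega
  rw [term_shift s a g j hs]
  refine IndepBlob.tail_ge_of_companion_cloud g a x hx hx1 (fun k => (hg k).1) (fun k => (hg k).2) L k₀ hk₀ hk₀x hheavy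
    (j - s) (by omega) fun y w hy hw hsum => hcloud y w hy hw (by omega)

/-- **γ⁗₁ — ONE LIGHT BLOB AND ONE COMPANION.**  Gates in `[0,1]`, floor `1/2 ≤ x ≤ 1`, blobs `ℓ ≠ k₀` with `x ≤ g k₀`, every
other blob heavy; with `A'' = Σ_{k ∉ {k₀, ℓ}} a k`: `2j + 1 ≤ A'' + 2a k₀ + 2s`, `2j + 1 ≤ A'' + a k₀ + a ℓ + 2s`, and the ODDS
condition `x(1 − g k₀)(1 − g ℓ) ≤ (1 − x) g k₀ g ℓ`.  Then `x ≤ TERM[s, a, g, j]` (the lead's `tail_ge_of_companion_oneLight` at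
layer `j − s`; for `g ℓ ≥ 1/2` every heavy blob of size `≥` the shortfall is a companion). [this work] -/
theorem term_ge_of_companionOneLight (s : ℕ) (a : κ → ℕ) (g : κ → ℝ) (j : ℕ) (x : ℝ) (hx : 1 / 2 ≤ x) (hx1 : x ≤ 1)
    (hg : ∀ k, 0 ≤ g k ∧ g k ≤ 1) (ℓ k₀ : κ) (hne : k₀ ≠ ℓ) (hk₀x : x ≤ g k₀)
    (hheavy : ∀ k, k ≠ k₀ → k ≠ ℓ → x ≤ g k)
    (hbig : 2 * j + 1 ≤ (∑ k ∈ ({k₀, ℓ} : Finset κ)ᶜ, a k) + 2 * a k₀ + 2 * s)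
    (hbℓ : 2 * j + 1 ≤ (∑ k ∈ ({k₀, ℓ} : Finset κ)ᶜ, a k) + a k₀ + a ℓ + 2 * s)
    (hodds : x * (1 - g k₀) * (1 - g ℓ) ≤ (1 - x) * g k₀ * g ℓ) :
    x ≤ TERM[s, a, g, j] := by
  by_cases hsj : j + 1 ≤ s
  · rw [term_eq_one_of_sure s a g j hsj]; exact hx1
  have hs : s ≤ j := by omega
  rw [term_shift s a g j hs]
  exact IndepBlob.tail_ge_of_companion_oneLight g a x hx hx1 (fun k => (hg k).1) (fun k => (hg k).2) ℓ k₀ hne hk₀x hheavy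
    (j - s) (by omega) (by omega) hodds

/-- **THE MATCHING ROW AS A TERM RULE.**  Gates in `[0,1]`, floor `1/2 ≤ x < 1`; a finset `L` of blobs (any gates) with a companion
map `c`, injective on `L`, `c ℓ ∉ L`, `x ≤ g (c ℓ)`, `a ℓ ≤ a (c ℓ)` and the odds condition `x(1 − g (c ℓ))(1 − g ℓ) ≤ (1 − x)·g (c ℓ)·g ℓ`
for every `ℓ ∈ L`; every blob outside `L` heavy; sizes with the sure shift totalling `2j + 1 ≤ Σ a + 2s`.  Then `x ≤ TERM[s, a, g, j]`
(the lead's `IndepBlob.tail_ge_of_matched_companions` at layer `j − s`; void (β) when `s ≥ j + 1`).  With light gates `≥ 1/2` the odds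
condition holds for every heavy companion. [this work] -/
theorem term_ge_of_matchedCompanions (s : ℕ) (a : κ → ℕ) (g : κ → ℝ) (j : ℕ) (x : ℝ) (hx : 1 / 2 ≤ x) (hx1 : x < 1)
    (hg : ∀ k, 0 ≤ g k ∧ g k ≤ 1) (L : Finset κ) (c : κ → κ) (hcL : ∀ ℓ ∈ L, c ℓ ∉ L)
    (hcinj : ∀ ℓ₁ ∈ L, ∀ ℓ₂ ∈ L, c ℓ₁ = c ℓ₂ → ℓ₁ = ℓ₂) (hcx : ∀ ℓ ∈ L, x ≤ g (c ℓ))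
    (hsize : ∀ ℓ ∈ L, a ℓ ≤ a (c ℓ)) (hodds : ∀ ℓ ∈ L, x * (1 - g (c ℓ)) * (1 - g ℓ) ≤ (1 - x) * g (c ℓ) * g ℓ)
    (hheavy : ∀ k, k ∉ L → x ≤ g k) (htot : 2 * j + 1 ≤ (∑ k, a k) + 2 * s) :
    x ≤ TERM[s, a, g, j] := by
  by_cases hsj : j + 1 ≤ s
  · rw [term_eq_one_of_sure s a g j hsj]; exact hx1.le
  have hs : s ≤ j := by omega
  rw [term_shift s a g j hs]
  exact IndepBlob.tail_ge_of_matched_companions g a x hx hx1 (fun k => (hg k).1) (fun k => (hg k).2) L c hcL hcinj hcx hsize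
    hodds hheavy (j - s) (by omega)

end RootDec

end Quant

end Summit.CriticalPhenomena.PercolationContinuityZ3.Theorems
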